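import HarnessLib
import Summits.RiemannHypothesis.RiemannHypothesis.Theorems.WeilFormatCDataA1TabValid1
import Summits.RiemannHypothesis.RiemannHypothesis.Theorems.WeilFormatCDataA1TabValidK2
import Summits.RiemannHypothesis.RiemannHypothesis.Theorems.WeilFormatCDataA1TabValidK3
import Summits.Ventures.WeilGRH.TwistedGramCellCheckCK
import Summits.Ventures.WeilGRH.TwistedGramCellConsts
import Literature.NumberTheory.LFunctions.WeilExplicitDirichletConj
import Summits.Ventures.WeilGRH.KCellsMod10OneAData2

/-!
SPLIT 3/3: the data and the kernel blocks of cell `c10h2` are in `KCellsMod10OneAData1`, `KCellsMod10OneAData2`; this file carries the last blocks, the glue, the PSD certificate and the theorems.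
ENGINE v2 (weil-grh-2 gen15): cell checker `K` (`TwistedGramCellCheckCK`: far rows tabulated once, Schur column sums by ONE Kronecker big-integer product per pair, front door `TwistedEncl.weilPositivityOnChar_of_checkCellK`); the midpoint matrix `D` and the Cholesky factor `L` are carried PACKED (one numeral per row, 64-bit words offset `2^63`, `PsdDyadic.unpackSq` / `unpackTri`) — the statements proved are unchanged.
# χ-cell mod 10 at `t = 1` — the LIFT of the even real character `(5/·)` to level 10: Weil positivity for `L(s, χ)` on `[−1, 1]`

Cell `rh-explicit`, WEIL TRACK — GRH ARM (engine seat weil-grh-2 gen14).  Kernel-checked INSTANCES of the parity-0 complex data door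
`weilPositivityOnChar_of_twistedC_formatC_dataJ` (order `J = 1`) via the cell checker's front door `TwistedEncl.weilPositivityOnChar_of_checkCellC`
(`TwistedGramCellCheckC` / `…CDoor`) at the window `a = 1` of the internal `ζ` record `WeilFormatCData.A1` (prime powers `2, 3, 4, 5, 7 < e²`,
`S = 2^256`; table validity below `101` assembled inside each proof from weil-2's kernel facts `tabv26`, `tTF26`, …).
The character values are general roots of unity (orders not square-root expressible in general), so `χ(k)` enters the cell checker through
kernel-certified BOXES: `Xtabf10a[j] ∋ e(m_j/4) = exp(2πi·m_j/4)` for the exponents `m_j` of `mtabf10a` (`MC.expI` on the table's `π` box, ONE kernel check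
`tXf10a`; membership `hXf10a` by `MC.mem_expI`), and `χ(k) = χ(3)^e = exp(2πi·h·e/4)` for `k ≡ 3^e (mod 10)` from the class hypothesis `χ(3) = exp(2πi/4)^h`
(`3` generates `(ℤ/10)ˣ`, order 4; local `apply_eq` in each `hXs…`).  SHARED (tag `f10a`): `LQf10a ∋ log 10`, `CCf10a ∋ a(1+E(2a))`, `AOPf10a ∋ Σ Λ(k)/√k·2cos(π/(n_k+2))`
(floors `[2, 1, 1, 1, 1]`), the cell shape `df10a` — block `B = 28` (`55 × 55` on `|p| < 28`), Schur columns `28 ≤ |p| < 100`, far weights `wN` (units `2^-40`,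
shaved `2^16` below the kernel's `dhatCBoxA` lower bounds), crude floor `d₀` (all depend on `q` only) — and ONE sign check `tSCf10a`.
PER CELL: the five boxes `Xs…` of `χ(2), χ(3), χ(4), χ(5), χ(7)`, tail parameters `θ, η`, dyadic midpoints `D…` (units `2^-60`, radius `ρ`) and the integer
Cholesky factor `L…` of `D − δ` (kernel margin `λ` informative); all 2B−1 rows checked by ONE `checkCellCRows` kernel call (`maxRecDepth 200000`), `PsdDyadic.checkPsdMid`.
CLASSES: `χ(3) = e(2/4)` (Conrey 10.9 / conj. 10.9, order 2, λ = 0.166).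
Final theorems `weilPositivityOnChar_mod10_chi<m>_one (χ : DirichletCharacter ℂ 10) (hχ : χ (3 : ZMod 10) = exp(2πi/4) ^ h) : WeilPositivityOnChar χ 1` and
the readable corollary `weilPositivityOnChar_mod_ten_one_of_real_3n (h3 : χ 3 = −1)` (the class is self-conjugate — the lift of the real character `(5/·)` — so there is no `_conj` twin). WHY THIS CELL: Weil positivity is inherited along the level (`WeilPositivityOnChar.changeLevel`) from the conductor, except where the conductor-level statement is out of reach — `(5/·)` at level 5 (margin ≈ 2·10⁻⁶); the lifts to 15, 20, 25 are in the tree, this is the smallest level, 10 (it gives 20, 30, 40, … by `changeLevel`).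
Pure data + kernel checks + the typed door; RH/GRH-free; standard axioms.  References: H. Yoshida (1992) §§5–7 [Yoshida1992HermitianForms];
R. E. Moore (1966) Ch. 3 [Moore1966]; N. J. Higham (2002) [Higham2002ASNA].
-/

set_option linter.style.longLine false

noncomputable section

namespace Summit.Ventures.WeilGRH.KCellsMod10OneA
open Literature.NumberTheory.LFunctions Literature.NumberTheory.LFunctions.Yoshida1992 Encl
open Literature.Analysis.ValidatedNumerics.NumericsMP Literature.Analysis.SpecialFunctions
open Summit.RiemannHypothesis.RiemannHypothesis.Theorems.WeilFormatCData.A1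
open Summit.Ventures.WeilGRH.TwistedEncl
open scoped Real ComplexConjugate
set_option maxRecDepth 200000 in
/-- cell `c10h2`, rows `42…54`, columns `0…27` (checker `K`): re-computed entries within `ρ·2^-60` of the midpoints (one kernel call). [cite: Moore1966, Ch. 3 (interval arithmetic: inclusion property)] -/
theorem tK42x0c10h2 : checkCellKBlock (2 ^ 256) C (Xsc10h2.map MC.re) (Xsc10h2.map MC.im) LQf10a tab df10a ec10h2 60 2 (PsdDyadic.unpackSq 64 55 DPc10h2) 42 13 0 28 = true := by
  set_option maxHeartbeats 0 in decide +kernel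
set_option maxRecDepth 200000 in
/-- cell `c10h2`, rows `42…54`, columns `28…54` (checker `K`): re-computed entries within `ρ·2^-60` of the midpoints (one kernel call). [cite: Moore1966, Ch. 3 (interval arithmetic: inclusion property)] -/
theorem tK42x28c10h2 : checkCellKBlock (2 ^ 256) C (Xsc10h2.map MC.re) (Xsc10h2.map MC.im) LQf10a tab df10a ec10h2 60 2 (PsdDyadic.unpackSq 64 55 DPc10h2) 42 13 28 27 = true := by
  set_option maxHeartbeats 0 in decide +kernel
/-- cell `c10h2`, rows `0…13`, all columns (glued). [folklore] -/
theorem tK0c10h2 : checkCellKBlock (2 ^ 256) C (Xsc10h2.map MC.re) (Xsc10h2.map MC.im) LQf10a tab df10a ec10h2 60 2 (PsdDyadic.unpackSq 64 55 DPc10h2) 0 14 0 55 = true :=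
  (checkCellKBlock_glueCols tK0x0c10h2 tK0x28c10h2 rfl rfl)
/-- cell `c10h2`, rows `14…27`, all columns (glued). [folklore] -/
theorem tK14c10h2 : checkCellKBlock (2 ^ 256) C (Xsc10h2.map MC.re) (Xsc10h2.map MC.im) LQf10a tab df10a ec10h2 60 2 (PsdDyadic.unpackSq 64 55 DPc10h2) 14 14 0 55 = true :=
  (checkCellKBlock_glueCols tK14x0c10h2 tK14x28c10h2 rfl rfl)
/-- cell `c10h2`, rows `28…41`, all columns (glued). [folklore] -/
theorem tK28c10h2 : checkCellKBlock (2 ^ 256) C (Xsc10h2.map MC.re) (Xsc10h2.map MC.im) LQf10a tab df10a ec10h2 60 2 (PsdDyadic.unpackSq 64 55 DPc10h2) 28 14 0 55 = true :=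
  (checkCellKBlock_glueCols tK28x0c10h2 tK28x28c10h2 rfl rfl)
/-- cell `c10h2`, rows `42…54`, all columns (glued). [folklore] -/
theorem tK42c10h2 : checkCellKBlock (2 ^ 256) C (Xsc10h2.map MC.re) (Xsc10h2.map MC.im) LQf10a tab df10a ec10h2 60 2 (PsdDyadic.unpackSq 64 55 DPc10h2) 42 13 0 55 = true :=
  (checkCellKBlock_glueCols tK42x0c10h2 tK42x28c10h2 rfl rfl)
/-- cell `c10h2`: the full `55 × 55` block (checker `K`, glued). [folklore] -/
theorem tRowsc10h2 : checkCellKBlock (2 ^ 256) C (Xsc10h2.map MC.re) (Xsc10h2.map MC.im) LQf10a tab df10a ec10h2 60 2 (PsdDyadic.unpackSq 64 55 DPc10h2) 0 55 0 55 = true :=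
  (checkCellKBlock_glueRows (checkCellKBlock_glueRows (checkCellKBlock_glueRows tK0c10h2 tK14c10h2 rfl rfl) tK28c10h2 rfl rfl) tK42c10h2 rfl rfl)
/-- `D − δ ≽ 0` with row slack `≥ ρ`. [cite: Higham2002ASNA, Thm. 10.3 / 10.5 (Cholesky backward error; Wilkinson–Demmel)] -/
theorem tPsdc10h2 : PsdDyadic.checkPsdMid 55 95919432729531440 2 (PsdDyadic.unpackSq 64 55 DPc10h2) (PsdDyadic.unpackTri 64 LPc10h2) = true := by
  decide +kernel
/-- cell `c10h2`: the five character values lie in the boxes `Xsc10h2`. [folklore] -/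
theorem hXsc10h2 (χ : DirichletCharacter ℂ 10) (hχ : χ (3 : ZMod 10) = Complex.exp (2 * ↑Real.pi * Complex.I / 4) ^ 2) :
    ∀ i < ks.length, MC.mem (2 ^ 256) (χ ((((ks.getD i default).val : ℕ)) : ZMod 10)) (Xsc10h2.getD i default) := by
  have apply_eq : ∀ k e m : ℕ, ((k : ℕ) : ZMod 10) = (3 : ZMod 10) ^ e → 2 * e = m →
      χ ((k : ℕ) : ZMod 10) = Complex.exp (((2 * π * (m : ℕ) / 4 : ℝ)) * Complex.I) := by
    intro k e m hk hm
    rw [hk, map_pow, hχ, ← pow_mul, hm, ← Complex.exp_nat_mul]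
    congr 1
    push_cast
    ring
  intro i hi
  have hi5 : i < 5 := by simpa [ks] using hi
  interval_cases i
  · show MC.mem (2 ^ 256) (χ (((PrimeLen.val ⟨2, 1⟩ : ℕ)) : ZMod 10)) (MC.ofInt (2 ^ 256) 0)
    rw [show (PrimeLen.val ⟨2, 1⟩ : ℕ) = 2 from rfl, MulChar.map_nonunit χ (by rw [ZMod.isUnit_iff_coprime]; decide)]
    exact_mod_cast MC.mem_ofInt (2 ^ 256) 0
  · show MC.mem (2 ^ 256) (χ (((PrimeLen.val ⟨3, 1⟩ : ℕ)) : ZMod 10)) (Xtabf10a.getD 0 default)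
    rw [show (PrimeLen.val ⟨3, 1⟩ : ℕ) = 3 from rfl, apply_eq 3 1 2 (by decide +kernel) rfl]
    exact hXf10a 0 (by norm_num)
  · show MC.mem (2 ^ 256) (χ (((PrimeLen.val ⟨2, 2⟩ : ℕ)) : ZMod 10)) (MC.ofInt (2 ^ 256) 0)
    rw [show (PrimeLen.val ⟨2, 2⟩ : ℕ) = 4 from rfl, MulChar.map_nonunit χ (by rw [ZMod.isUnit_iff_coprime]; decide)]
    exact_mod_cast MC.mem_ofInt (2 ^ 256) 0
  · show MC.mem (2 ^ 256) (χ (((PrimeLen.val ⟨5, 1⟩ : ℕ)) : ZMod 10)) (MC.ofInt (2 ^ 256) 0)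
    rw [show (PrimeLen.val ⟨5, 1⟩ : ℕ) = 5 from rfl, MulChar.map_nonunit χ (by rw [ZMod.isUnit_iff_coprime]; decide)]
    exact_mod_cast MC.mem_ofInt (2 ^ 256) 0
  · show MC.mem (2 ^ 256) (χ (((PrimeLen.val ⟨7, 1⟩ : ℕ)) : ZMod 10)) (Xtabf10a.getD 1 default)
    rw [show (PrimeLen.val ⟨7, 1⟩ : ℕ) = 7 from rfl, apply_eq 7 3 6 (by decide +kernel) rfl]
    exact hXf10a 1 (by norm_num)
/-- ★ **Weil positivity on `[−1, 1]` for `L(s, χ)`, `χ` mod 10 with `χ(3) = e(2/4)`** (Conrey `10.9`, order 2; door C at `a = 1`,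
shape `28`/`100`, kernel margin `λ = 0.1664`). -/
theorem weilPositivityOnChar_mod10_chi9_one (χ : DirichletCharacter ℂ 10) (hχ : χ (3 : ZMod 10) = Complex.exp (2 * ↑Real.pi * Complex.I / 4) ^ 2) :
    WeilPositivityOnChar χ 1 := by
  have hXs := hXsc10h2 χ hχ
  have hx : ∀ i < ks.length, MI.mem (2 ^ 256) (χ ((((ks.getD i default).val : ℕ)) : ZMod 10)).re ((Xsc10h2.map MC.re).getD i default) := fun i hi ↦ by
    show MI.mem _ _ ((Xsc10h2.map MC.re).getD i (MC.re default)); rw [List.getD_map]; exact (hXs i hi).1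
  have hy : ∀ i < ks.length, MI.mem (2 ^ 256) (χ ((((ks.getD i default).val : ℕ)) : ZMod 10)).im ((Xsc10h2.map MC.im).getD i default) := fun i hi ↦ by
    show MI.mem _ _ ((Xsc10h2.map MC.im).getD i (MC.im default)); rw [List.getD_map]; exact (hXs i hi).2
  have hT : TabValid (2 ^ 256) a ks 101 tab :=
    (((((tabv26).extend fun n hn hnk ↦ FastLight.idxValid_of_checkTableFast (by norm_num) a_pos consts_valid tTF26 hn hnk).extend fun n hn hnk ↦ FastLight.idxValid_of_checkTableFast (by norm_num) a_pos consts_valid tTF41 hn hnk).extend fun n hn hnk ↦ FastLight.idxValid_of_checkTableFast (by norm_num) a_pos consts_valid tTF56 hn hnk).extend fun n hn hnk ↦ FastLight.idxValid_of_checkTableFast (by norm_num) a_pos consts_valid tTF71 hn hnk).extend fun n hn hnk ↦ FastLight.idxValid_of_checkTableFast (by norm_num) a_pos consts_valid tTF86 hn hnk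
  have h := weilPositivityOnChar_of_checkCellK (q := 10) (by norm_num) (by positivity) a_pos (Karc := 128) primeData consts_valid χ hx hy
    hLQf10a hT (d := df10a) (e := ec10h2) (by decide) hCCf10a hAOPf10a tSCf10a tHDc10h2 tRowsc10h2 tPsdc10h2
  convert h using 2
  norm_num [a]
/-- ★★ **The LIFT of `(5/·)` to level 10 is Weil-positive on `[−1, 1]`**: every Dirichlet character `χ` mod 10 with `χ(3) = −1`
(there is exactly one: the even real character induced from the Kronecker symbol `(5/·)`, conductor `5`; `(ℤ/10)ˣ = ⟨3⟩`) satisfies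
`WeilPositivityOnChar χ 1` — `weilPositivityOnChar_mod10_chi9_one` with `e(2/4) = −1`.  With the tree's odd floor (`10 ∉ R₁`: the two odd characters mod 10, conductor 5)
this is «every non-principal character mod 10»; at level `5` itself the finite-section margin of `(5/·)` at `t = 1` is `≈ 2·10⁻⁶`
(EXTREMALS/GRH/A2-TABLE) and no certificate exists. -/
theorem weilPositivityOnChar_mod_ten_one_of_real_3n (χ : DirichletCharacter ℂ 10) (h3 : χ (3 : ZMod 10) = -1) : WeilPositivityOnChar χ 1 := by
  have hζ : Complex.exp (2 * ↑Real.pi * Complex.I / 4) ^ 2 = -1 := by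
    rw [← Complex.exp_nat_mul, show ((2 : ℕ) : ℂ) * (2 * ↑Real.pi * Complex.I / 4) = ↑Real.pi * Complex.I by push_cast; ring]
    exact Complex.exp_pi_mul_I
  exact weilPositivityOnChar_mod10_chi9_one χ (by rw [h3, hζ])

end Summit.Ventures.WeilGRH.KCellsMod10OneA

end
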